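import Mathlib

/-!
# `FidelityWitnesses.RankTwoAdditivity` (stmt-MatrixMultiplication-4964) — finite-sum Hermitian toolkit

Elementary identities and inequalities for finite families of complex numbers used in the proof of
`RankTwoAdditivity` (`M(n,2) = 2`): Cauchy–Schwarz in the form `|Σ conj(f) g|² ≤ ‖f‖² ‖g‖²`,
polarisation of `‖f + g‖²`, the norm of a triad and of a sum of two triads
`‖w₁⊗u₁⊗v₁ + w₂⊗u₂⊗v₂‖² = ‖w₁‖²‖u₁‖²‖v₁‖² + ‖w₂‖²‖u₂‖²‖v₂‖² + 2 Re(⟨w₁,w₂⟩⟨u₁,u₂⟩⟨v₁,v₂⟩)`,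
submultiplicativity `‖XY‖² ≤ ‖X‖²‖Y‖²` in array form, and the real-arithmetic lemma `zstep_real`
that assembles the elimination of the third tensor factor.  Supports item
`stmt-MatrixMultiplication-4964`; no definitions are introduced.
-/

namespace Summit.MatrixMultiplication.MatrixMultiplication.Theorems.RankTwoAdditivity

open scoped BigOperators ComplexConjugate

/-- Cauchy–Schwarz for the Hermitian pairing of two complex arrays. [folklore] -/
theorem norm_sq_hsum_le {ι : Type*} [Fintype ι] (f g : ι → ℂ) :
    ‖∑ i, conj (f i) * g i‖ ^ 2 ≤ (∑ i, ‖f i‖ ^ 2) * ∑ i, ‖g i‖ ^ 2 := by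
  have h1 : ‖∑ i, conj (f i) * g i‖ ≤ ∑ i, ‖f i‖ * ‖g i‖ :=
    (norm_sum_le _ _).trans (le_of_eq (Finset.sum_congr rfl fun i _ => by
      rw [norm_mul, Complex.norm_conj]))
  calc ‖∑ i, conj (f i) * g i‖ ^ 2 ≤ (∑ i, ‖f i‖ * ‖g i‖) ^ 2 :=
        pow_le_pow_left₀ (norm_nonneg _) h1 2
    _ ≤ (∑ i, ‖f i‖ ^ 2) * ∑ i, ‖g i‖ ^ 2 := Finset.sum_mul_sq_le_sq_mul_sq _ _ _

/-- Squared norm of a pointwise sum of two arrays. [folklore] -/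
theorem norm_sq_add_sum {ι : Type*} [Fintype ι] (f g : ι → ℂ) :
    (∑ i, ‖f i + g i‖ ^ 2) =
      (∑ i, ‖f i‖ ^ 2) + (∑ i, ‖g i‖ ^ 2) + 2 * (∑ i, conj (f i) * g i).re := by
  have h : ∀ i, ‖f i + g i‖ ^ 2 = ‖f i‖ ^ 2 + ‖g i‖ ^ 2 + 2 * (conj (f i) * g i).re := by
    intro i
    rw [← Complex.normSq_eq_norm_sq, ← Complex.normSq_eq_norm_sq, ← Complex.normSq_eq_norm_sq,
      Complex.normSq_add]
    congr 1
    rw [← Complex.conj_conj (f i * conj (g i)), map_mul, Complex.conj_conj, Complex.conj_re]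
  simp_rw [h]
  rw [Finset.sum_add_distrib, Finset.sum_add_distrib, Complex.re_sum, Finset.mul_sum]

/-- Submultiplicativity of the Frobenius norm in array form: `‖XY‖² ≤ ‖X‖²‖Y‖²`. [folklore] -/
theorem norm_sq_mul_le {ι κ μ : Type*} [Fintype ι] [Fintype κ] [Fintype μ]
    (u : ι × κ → ℂ) (v : κ × μ → ℂ) (A : ι × μ → ℂ)
    (hA : ∀ a, A a = ∑ m, u (a.1, m) * v (m, a.2)) :
    (∑ a, ‖A a‖ ^ 2) ≤ (∑ b, ‖u b‖ ^ 2) * ∑ c, ‖v c‖ ^ 2 := by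
  have hrow : ∀ a : ι × μ, ‖A a‖ ^ 2 ≤ (∑ m, ‖u (a.1, m)‖ ^ 2) * ∑ m, ‖v (m, a.2)‖ ^ 2 := by
    intro a
    rw [hA]
    have h1 : ‖∑ m, u (a.1, m) * v (m, a.2)‖ ≤ ∑ m, ‖u (a.1, m)‖ * ‖v (m, a.2)‖ :=
      (norm_sum_le _ _).trans (le_of_eq (Finset.sum_congr rfl fun m _ => norm_mul _ _))
    calc ‖∑ m, u (a.1, m) * v (m, a.2)‖ ^ 2 ≤ (∑ m, ‖u (a.1, m)‖ * ‖v (m, a.2)‖) ^ 2 :=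
          pow_le_pow_left₀ (norm_nonneg _) h1 2
      _ ≤ (∑ m, ‖u (a.1, m)‖ ^ 2) * ∑ m, ‖v (m, a.2)‖ ^ 2 := Finset.sum_mul_sq_le_sq_mul_sq _ _ _
  set U : ι → ℝ := fun i => ∑ m, ‖u (i, m)‖ ^ 2 with hU
  set V : μ → ℝ := fun y => ∑ m, ‖v (m, y)‖ ^ 2 with hV
  have hUsum : ∑ i, U i = ∑ b, ‖u b‖ ^ 2 := by
    rw [Fintype.sum_prod_type (f := fun b => ‖u b‖ ^ 2)]
  have hVsum : ∑ y, V y = ∑ c, ‖v c‖ ^ 2 := by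
    rw [Fintype.sum_prod_type (f := fun c => ‖v c‖ ^ 2), Finset.sum_comm]
  calc (∑ a, ‖A a‖ ^ 2) ≤ ∑ a : ι × μ, U a.1 * V a.2 :=
        Finset.sum_le_sum fun a _ => hrow a
    _ = ∑ i, ∑ y, U i * V y := by rw [Fintype.sum_prod_type]
    _ = (∑ i, U i) * ∑ y, V y := (Fintype.sum_mul_sum U V).symm
    _ = (∑ b, ‖u b‖ ^ 2) * ∑ c, ‖v c‖ ^ 2 := by rw [hUsum, hVsum]

/-- Real-arithmetic heart of the weighted Cauchy–Schwarz step: if `α² ≤ F·Aq`, `β² ≤ W·Dq`,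
`Dq ≤ (2n₁ − Aq)·s` and `Aq ≤ n₁` (all quantities nonnegative) then `(α+β)² ≤ 2n₁(F + s W)`.
[folklore] -/
theorem zstep_real (α β F Aq W Dq n₁ s : ℝ) (hF : 0 ≤ F)
    (hW : 0 ≤ W) (hs : 0 ≤ s) (hAq : 0 ≤ Aq) (hαb : α ^ 2 ≤ F * Aq) (hβb : β ^ 2 ≤ W * Dq)
    (hD : Dq ≤ (2 * n₁ - Aq) * s) (hAn : Aq ≤ n₁) :
    (α + β) ^ 2 ≤ 2 * n₁ * (F + s * W) := by
  -- (αβ)² ≤ F·Aq·W·(2n₁−Aq)·s and AM–GM for the two products F(2n₁−Aq), Aq s W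
  have h1 : β ^ 2 ≤ W * ((2 * n₁ - Aq) * s) := hβb.trans (mul_le_mul_of_nonneg_left hD hW)
  have hprod : (α * β) ^ 2 ≤ (F * (2 * n₁ - Aq)) * (Aq * s * W) := by
    have := mul_le_mul hαb h1 (by positivity) (by positivity)
    calc (α * β) ^ 2 = α ^ 2 * β ^ 2 := by ring
      _ ≤ F * Aq * (W * ((2 * n₁ - Aq) * s)) := this
      _ = (F * (2 * n₁ - Aq)) * (Aq * s * W) := by ring
  have hX : 0 ≤ F * (2 * n₁ - Aq) := mul_nonneg hF (by linarith)
  have hY : 0 ≤ Aq * s * W := by positivity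
  -- 2αβ ≤ F(2n₁−Aq) + Aq s W
  have h2 : 2 * (α * β) ≤ F * (2 * n₁ - Aq) + Aq * s * W := by
    by_cases hab : α * β ≤ 0
    · linarith [hX, hY]
    · have hab : 0 < α * β := lt_of_not_ge hab
      nlinarith [sq_nonneg (F * (2 * n₁ - Aq) - Aq * s * W), hprod, hX, hY,
        sq_nonneg (2 * (α * β) - (F * (2 * n₁ - Aq) + Aq * s * W))]
  nlinarith [h1, hαb, h2]

/-- Norm-square of a single triad array: `Σ_{a,b,c} ‖w a u b v c‖² = ‖w‖²‖u‖²‖v‖²`. [folklore] -/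
theorem norm_sq_triad {α β γ : Type*} [Fintype α] [Fintype β] [Fintype γ]
    (w : α → ℂ) (u : β → ℂ) (v : γ → ℂ) :
    (∑ t : α × β × γ, ‖w t.1 * u t.2.1 * v t.2.2‖ ^ 2) =
      (∑ a, ‖w a‖ ^ 2) * ((∑ b, ‖u b‖ ^ 2) * ∑ c, ‖v c‖ ^ 2) := by
  rw [Fintype.sum_prod_type (f := fun t : α × β × γ => ‖w t.1 * u t.2.1 * v t.2.2‖ ^ 2),
    Fintype.sum_mul_sum (fun b => ‖u b‖ ^ 2) (fun c => ‖v c‖ ^ 2),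
    Fintype.sum_mul_sum (fun a => ‖w a‖ ^ 2) (fun b => ∑ c, ‖u b‖ ^ 2 * ‖v c‖ ^ 2)]
  refine Finset.sum_congr rfl fun a _ => ?_
  rw [Fintype.sum_prod_type (f := fun q : β × γ => ‖w (a, q).1 * u (a, q).2.1 * v (a, q).2.2‖ ^ 2)]
  refine Finset.sum_congr rfl fun b _ => ?_
  rw [Finset.mul_sum]
  refine Finset.sum_congr rfl fun c _ => ?_
  rw [norm_mul, norm_mul]; ring

/-- Pairing of two triad arrays: `Σ conj(w₁u₁v₁)·(w₂u₂v₂) = ⟨w₁,w₂⟩⟨u₁,u₂⟩⟨v₁,v₂⟩`. [folklore] -/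
theorem hsum_triad {α β γ : Type*} [Fintype α] [Fintype β] [Fintype γ]
    (w₁ w₂ : α → ℂ) (u₁ u₂ : β → ℂ) (v₁ v₂ : γ → ℂ) :
    (∑ t : α × β × γ, conj (w₁ t.1 * u₁ t.2.1 * v₁ t.2.2) * (w₂ t.1 * u₂ t.2.1 * v₂ t.2.2)) =
      (∑ a, conj (w₁ a) * w₂ a) * ((∑ b, conj (u₁ b) * u₂ b) * ∑ c, conj (v₁ c) * v₂ c) := by
  rw [Fintype.sum_prod_type (f := fun t : α × β × γ =>
        conj (w₁ t.1 * u₁ t.2.1 * v₁ t.2.2) * (w₂ t.1 * u₂ t.2.1 * v₂ t.2.2)),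
    Fintype.sum_mul_sum (fun b => conj (u₁ b) * u₂ b) (fun c => conj (v₁ c) * v₂ c),
    Fintype.sum_mul_sum (fun a => conj (w₁ a) * w₂ a)
      (fun b => ∑ c, conj (u₁ b) * u₂ b * (conj (v₁ c) * v₂ c))]
  refine Finset.sum_congr rfl fun a _ => ?_
  rw [Fintype.sum_prod_type (f := fun q : β × γ =>
        conj (w₁ (a, q).1 * u₁ (a, q).2.1 * v₁ (a, q).2.2) * (w₂ (a, q).1 * u₂ (a, q).2.1 * v₂ (a, q).2.2))]
  refine Finset.sum_congr rfl fun b _ => ?_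
  rw [Finset.mul_sum]
  refine Finset.sum_congr rfl fun c _ => ?_
  simp only [map_mul]; ring

/-- Norm-square of a sum of two triads (the `‖S‖²` of a rank-`≤ 2` tensor). [folklore] -/
theorem norm_sq_two_triads {α β γ : Type*} [Fintype α] [Fintype β] [Fintype γ]
    (w₁ w₂ : α → ℂ) (u₁ u₂ : β → ℂ) (v₁ v₂ : γ → ℂ) :
    (∑ a, ∑ b, ∑ c, ‖w₁ a * u₁ b * v₁ c + w₂ a * u₂ b * v₂ c‖ ^ 2) =
      (∑ a, ‖w₁ a‖ ^ 2) * ((∑ b, ‖u₁ b‖ ^ 2) * ∑ c, ‖v₁ c‖ ^ 2)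
      + (∑ a, ‖w₂ a‖ ^ 2) * ((∑ b, ‖u₂ b‖ ^ 2) * ∑ c, ‖v₂ c‖ ^ 2)
      + 2 * ((∑ a, conj (w₁ a) * w₂ a) *
              ((∑ b, conj (u₁ b) * u₂ b) * ∑ c, conj (v₁ c) * v₂ c)).re := by
  have h : (∑ a, ∑ b, ∑ c, ‖w₁ a * u₁ b * v₁ c + w₂ a * u₂ b * v₂ c‖ ^ 2) =
      ∑ t : α × β × γ, ‖w₁ t.1 * u₁ t.2.1 * v₁ t.2.2 + w₂ t.1 * u₂ t.2.1 * v₂ t.2.2‖ ^ 2 := by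
    rw [Fintype.sum_prod_type (f := fun t : α × β × γ =>
      ‖w₁ t.1 * u₁ t.2.1 * v₁ t.2.2 + w₂ t.1 * u₂ t.2.1 * v₂ t.2.2‖ ^ 2)]
    refine Finset.sum_congr rfl fun a _ => ?_
    rw [Fintype.sum_prod_type (f := fun q : β × γ =>
      ‖w₁ (a, q).1 * u₁ (a, q).2.1 * v₁ (a, q).2.2 + w₂ (a, q).1 * u₂ (a, q).2.1 * v₂ (a, q).2.2‖ ^ 2)]
  rw [h, norm_sq_add_sum, norm_sq_triad, norm_sq_triad, hsum_triad]

/-- If `‖u‖²‖v‖² = 0` then the product array `XY` vanishes. [folklore] -/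
theorem prod_eq_zero_of_norms {ι κ μ : Type*} [Fintype ι] [Fintype κ] [Fintype μ]
    (u : ι × κ → ℂ) (v : κ × μ → ℂ) (A : ι × μ → ℂ)
    (hA : ∀ a, A a = ∑ m, u (a.1, m) * v (m, a.2))
    (h : (∑ b, ‖u b‖ ^ 2) * (∑ c, ‖v c‖ ^ 2) = 0) : ∀ a, A a = 0 := by
  intro a
  rw [hA]
  rcases mul_eq_zero.mp h with h0 | h0
  · have hz : ∀ b, u b = 0 := by
      intro b
      have := (Finset.sum_eq_zero_iff_of_nonneg (fun b _ => by positivity)).mp h0 b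
        (Finset.mem_univ b)
      exact norm_eq_zero.mp (pow_eq_zero_iff (n := 2) (by norm_num) |>.mp this)
    exact Finset.sum_eq_zero fun m _ => by rw [hz, zero_mul]
  · have hz : ∀ c, v c = 0 := by
      intro c
      have := (Finset.sum_eq_zero_iff_of_nonneg (fun c _ => by positivity)).mp h0 c
        (Finset.mem_univ c)
      exact norm_eq_zero.mp (pow_eq_zero_iff (n := 2) (by norm_num) |>.mp this)
    exact Finset.sum_eq_zero fun m _ => by rw [hz, mul_zero]

end Summit.MatrixMultiplication.MatrixMultiplication.Theorems.RankTwoAdditivity
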